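import Literature.NumberTheory.GaloisRepresentations.ContinuousCohomologyAdditiveTransport
import Literature.NumberTheory.IwasawaTheory.Greenberg2016.SpecialisationTransfers
import HarnessLib

/-!
# Greenberg 2016, proof of Prop. 4.1.1 (p. 16): a Selmer specification and its global-to-local map
# do not see the ring of scalars — restriction of scalars `Λ' → Λ` for `Specification`, `φ_𝓛`,
# `S_𝓛`, `Q_𝓛`, `Ш²`, SUR, LEO, LOC⁽¹⁾ (definitions with bodies and theorems; no named fact)

Topic `NumberTheory/IwasawaTheory/Greenberg2016`; namespace
`Literature.NumberTheory.IwasawaTheory.Greenberg2016` (and, for the cochain-level lemmas of §1,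
`Literature.NumberTheory.GaloisRepresentations`). No named fact, no `sorry`, no instance, no notation.
Seat `bsd-input-gr16-prop411` (literature-prover, 2026-08-28): transfer step (T8) of the input (γ) of
`prop411_selmer_isAlmostDivisible_of_facts'` (`SelmerAlmostDivisibleOfFacts.lean`).

PRINT. In the proof of [Greenberg2016Selmer] Prop. 4.1.1 (p. 16 L1–8) Prop. 2.6.3 is applied to the
`(Λ/Π)`-module `𝐃[π]` "as a `Λ_Π`-module", where `Λ_Π ⊆ Λ/Π` is a formal power-series subring over
which `Λ/Π` is finite and integral (§2.4 p. 8 L17–22: "we will explain why those hypotheses are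
satisfied when `𝐃[Π]` is considered as a `Λ_Π`-module"); the conclusion "`φ_Π` is surjective" and
the hypotheses LEO, LOC_η⁽¹⁾, "`Ш² = 0`", divisibility of `Q_𝓛(K_η, ·)` are statements about the
underlying Galois cohomology GROUPS, which do not depend on whether the coefficients are read in
`Λ`, in `Λ/Π` or in `Λ_Π` ([Greenberg2010] §3.1 p. 14 L33–35: "The argument gives an isomorphism of
`ℤ_p`-modules if one just assumes that `D` is a discrete, `p`-primary abelian group with a continuous
action of Gal(K_Σ/K)"; [Brown1982CohomologyGroups] III.1 Ex. 3: the standard complex does not involve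
the ring of scalars). In the tree the cohomology `ρ.H n` of a continuous representation is TYPED by
its coefficient ring, so this remark has to be made a theorem: that is this file.

CONTENT. For a continuous representation `ρ` of `G_{K,Σ}` on a discrete `Λ`-module `𝐃` and a ring
of coefficients `P → Λ` (`[Algebra P Λ] [Module P 𝐃] [IsScalarTower P Λ 𝐃]`), with
`ρ|_P = ρ.restrictScalars P` (tree, `LabelledHodgeTateWeights.lean`) and the comparison
`e = ContinuousRep.restrictScalarsH P ρ n : Hⁿ(G, 𝐃|_P) ≃+ Hⁿ(G, 𝐃)` (tree,
`ContinuousCohomologyAdditiveTransport.lean`):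
* §1 `e` is SEMILINEAR: `e (a • x) = (algebraMap P Λ a) • e x` (`ContinuousRep.restrictScalarsH_smul`,
  from the cochain-level `continuousCohomologyAddEquiv_smul`);
* §2 `localRep S (ρ|_P) v = (localRep S ρ v)|_P` (definitional), the local comparisons
  `localRestrictScalarsH`, and their compatibility with the localisation maps `loc` (`loc_restrictScalarsH`);
* §3 the specification `L.restrictScalars P` of `ρ|_P` ("the same subgroups `L(K_v, 𝐃)`, read as
  `P`-submodules"), the comparisons `Q_{𝓛|_P}(K_v) ≃+ Q_𝓛(K_v)`, `Q_{𝓛|_P}(K) ≃+ Q_𝓛(K)` and the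
  commuting square with `φ_𝓛` (`QGlobalRestrictScalarsEquiv_phi`);
* §4 consequences: `SUR(𝐃|_P, 𝓛|_P) ↔ SUR(𝐃, 𝓛)`, `S_{𝓛|_P} = e⁻¹ S_𝓛`, `Ш²(𝐃|_P) = e⁻¹ Ш²(𝐃)`
  (so `Ш²(𝐃|_P) = 0 ↔ Ш²(𝐃) = 0`, whence LEO(𝐃|_P) from `Ш²(𝐃) = 0`), `LOC_v⁽¹⁾(𝐃|_P) ↔ LOC_v⁽¹⁾(𝐃)`
  (definitional), and `P`-divisibility of `Q_{𝓛|_P}(K_v, 𝐃|_P)` from divisibility of `Q_𝓛(K_v, 𝐃)`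
  by the scalars `algebraMap P Λ a`, `a ≠ 0`;
* §5 naturality of the comparisons with the maps induced in the coefficients (`restrictScalarsH_Hmap`,
  `localRestrictScalarsH_localScalar`) and `R`-stability of `𝓛|_P` from that of `𝓛`
  (`Specification.isStable_restrictScalars`).

HONESTY. Infrastructure only: nothing here proves Prop. 4.1.1, (γ), or any summit statement; BSD is
not advanced. AI-typed, kernel-checked.

## References
* R. Greenberg, *On the structure of Selmer groups*, in: Elliptic Curves, Modular Forms and Iwasawa
  Theory, Springer Proc. Math. Stat. 188 (2016) 225–252, §2.4 p. 8, proof of Prop. 4.1.1 p. 16.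
  [Greenberg2016Selmer]
* R. Greenberg, *Surjectivity of the global-to-local map defining a Selmer group*, Kyoto J. Math. 50
  (2010) 853–888, §3.1 p. 14. [Greenberg2010]
* K. S. Brown, *Cohomology of Groups* (1982), III.1 Example 3. [Brown1982CohomologyGroups]
-/

noncomputable section

open CategoryTheory

universe u v u'

namespace Literature.NumberTheory.GaloisRepresentations

/-! ## §1. The comparison isomorphisms are semilinear -/

section Semilinear

variable {k₁ : Type u} [Ring k₁] [TopologicalSpace k₁] {k₂ : Type u'} [Ring k₂] [TopologicalSpace k₂]
variable {G : Type v} [Group G] [TopologicalSpace G] [IsTopologicalGroup G]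
variable {X : TopRep.{v} k₁ G} {Y : TopRep.{v} k₂ G}
variable (η : (X : Type v) ≃ₜ+ (Y : Type v)) (hη : ∀ (g : G) (x : X), η (X.ρ g x) = Y.ρ g (η x))
variable (φ : k₁ → k₂) (hφ : ∀ (a : k₁) (x : X), η (a • x) = φ a • η x)

open TopRep ContRepresentation ContinuousCohomology

include hφ in
/-- If the identification `η` of the underlying topological `G`-modules is semilinear along a map of
scalars `φ : k₁ → k₂` (`η (a • x) = φ a • η x`), so are the level-wise identifications of the standard
resolutions. [cite: Brown1982CohomologyGroups, III.1 Example 3 (the standard complex does not involve the scalars)] -/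
theorem resolutionEquiv_smul : ∀ (m : ℕ) (a : k₁) (f : (TopRep.resolutionX X m : Type v)),
    resolutionEquiv η m (a • f) = φ a • resolutionEquiv η m f
  | 0, a, f => hφ a f
  | m + 1, a, f => by
    refine ContinuousMap.ext fun x => ?_
    change resolutionEquiv η m ((a • f) x) = φ a • resolutionEquiv η m (f x)
    rw [ContinuousMap.smul_apply]
    exact resolutionEquiv_smul m a (f x)

include hφ in
/-- Semilinearity of the identification of invariant homogeneous cochains.
[cite: Brown1982CohomologyGroups, III.1 Example 3 (the standard complex does not involve the scalars)] -/
theorem cochainsEquiv_smul (n : ℕ) (a : k₁) (c : ((TopRep.homogeneousCochains X).X n : Type v)) :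
    cochainsEquiv η hη n (a • c) = φ a • cochainsEquiv η hη n c :=
  Subtype.ext (resolutionEquiv_smul η φ hφ (n + 1) a c.1)

include hφ in
/-- **Semilinearity of `continuousCohomologyAddEquiv`**: `Hⁿ(G, X) ≃+ Hⁿ(G, Y)` satisfies
`e (a • x) = φ a • e x` whenever `η` does. [cite: Brown1982CohomologyGroups, III.1 Example 3 (the standard complex does not involve the scalars)] -/
theorem continuousCohomologyAddEquiv_smul (n : ℕ) (a : k₁) (x : continuousCohomology n X) :
    continuousCohomologyAddEquiv η hη n (a • x) = φ a • continuousCohomologyAddEquiv η hη n x := by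
  obtain ⟨c, hc, rfl⟩ := cxClass_surjective (TopRep.homogeneousCochains X) n (n + 1) (up_nat_next n) x
  rw [← cxClass_smul, continuousCohomologyAddEquiv_cxClass, continuousCohomologyAddEquiv_cxClass,
    ← cxClass_smul]
  exact cxClass_congr (cochainsEquiv_smul η hη φ hφ n a c)

end Semilinear

section RestrictScalars

variable {G : Type u} [Group G] [TopologicalSpace G] [IsTopologicalGroup G]
  {A₁ : Type u} [CommRing A₁] [TopologicalSpace A₁]
  {M₁ : Type u} [AddCommGroup M₁] [Module A₁ M₁] [TopologicalSpace M₁] [IsTopologicalAddGroup M₁]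
  [ContinuousSMul A₁ M₁]
  (P : Type u) [CommRing P] [TopologicalSpace P] [Algebra P A₁] [Module P M₁]
  [IsScalarTower P A₁ M₁] [ContinuousSMul P M₁]

/-- **`restrictScalarsH` is semilinear along `algebraMap P A₁`**: `e (a • x) = (algebraMap P A₁ a) • e x`
on `Hⁿ(G, M|_P) ≃+ Hⁿ(G, M)`. [cite: Brown1982CohomologyGroups, III.1 Example 3 (the standard complex does not involve the scalars)] -/
theorem ContinuousRep.restrictScalarsH_smul (ρ : ContinuousRep G A₁ M₁) (n : ℕ) (a : P)
    (x : (ρ.restrictScalars P).H n) :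
    ContinuousRep.restrictScalarsH P ρ n (a • x) =
      algebraMap P A₁ a • ContinuousRep.restrictScalarsH P ρ n x :=
  continuousCohomologyAddEquiv_smul (X := (ρ.restrictScalars P).toTopRep) (Y := ρ.toTopRep)
    (ContinuousAddEquiv.refl M₁) (fun _ _ ↦ rfl) (algebraMap P A₁)
    (fun a m ↦ (algebraMap_smul A₁ a m).symm) n a x

end RestrictScalars

end Literature.NumberTheory.GaloisRepresentations

/-! ## §2. Local representations, local comparisons, localisation maps -/

open scoped Classical
open NumberField IsDedekindDomain Field
open Literature.NumberTheory.GaloisRepresentations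

namespace Literature.NumberTheory.IwasawaTheory.Greenberg2016

section Local

variable {K : Type u} [Field K] [NumberField K] (S : Set (HeightOneSpectrum (𝓞 K)))
  {Λ : Type u} [CommRing Λ] [TopologicalSpace Λ]
  {D : Type u} [AddCommGroup D] [Module Λ D] [TopologicalSpace D] [DiscreteTopology D]
  [ContinuousSMul Λ D]
  (P : Type u) [CommRing P] [TopologicalSpace P] [Algebra P Λ] [Module P D]
  [IsScalarTower P Λ D] [ContinuousSMul P D]
  (ρ : ContinuousRep (GaloisGroupUnramifiedOutside K S) Λ D)

omit [DiscreteTopology D] [ContinuousSMul Λ D] [ContinuousSMul P D] in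
/-- `𝐃|_P` restricted to `Γ_{K_v}` is `(𝐃 restricted to Γ_{K_v})|_P` — definitionally.
[cite: Greenberg2016Selmer, §1 p. 3 L19–28] -/
theorem localRep_restrictScalars (v : Place K) :
    localRep S (ρ.restrictScalars P) v = (localRep S ρ v).restrictScalars P := rfl

/-- The local comparison `Hⁿ(K_v, 𝐃|_P) ≃+ Hⁿ(K_v, 𝐃)` (`restrictScalarsH` of `localRep`).
[cite: Greenberg2016Selmer, §2.4 p. 8 L17–22; §4.1 p. 16 L1–8] -/
def localRestrictScalarsH (v : Place K) (n : ℕ) :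
    (localRep S (ρ.restrictScalars P) v).H n ≃+ (localRep S ρ v).H n :=
  ContinuousRep.restrictScalarsH P (localRep S ρ v) n

/-- The local comparison is semilinear along `algebraMap P Λ`.
[cite: Brown1982CohomologyGroups, III.1 Example 3 (the standard complex does not involve the scalars)] -/
theorem localRestrictScalarsH_smul (v : Place K) (n : ℕ) (a : P)
    (x : (localRep S (ρ.restrictScalars P) v).H n) :
    localRestrictScalarsH S P ρ v n (a • x) = algebraMap P Λ a • localRestrictScalarsH S P ρ v n x :=
  ContinuousRep.restrictScalarsH_smul P (localRep S ρ v) n a x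

/-- **The comparisons commute with localisation**: `loc_v ∘ e = e_v ∘ loc_v`.
[cite: Brown1982CohomologyGroups, III.1 Example 3 (the standard complex does not involve the scalars)] -/
theorem loc_restrictScalarsH (v : Place K) (n : ℕ) (x : (ρ.restrictScalars P).H n) :
    loc S ρ v n (ContinuousRep.restrictScalarsH P ρ n x) =
      localRestrictScalarsH S P ρ v n (loc S (ρ.restrictScalars P) v n x) :=
  (ContinuousRep.restrictScalarsH_Hpullback P ρ (localToUnramified S v) n x).symm

end Local

/-! ## §3. The specification `𝓛|_P`, the comparisons of `Q_𝓛(K_v)`, `Q_𝓛(K)`, and the square with `φ_𝓛` -/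

section Spec

variable {K : Type u} [Field K] [NumberField K] {S : Set (HeightOneSpectrum (𝓞 K))}
  {Λ : Type u} [CommRing Λ] [TopologicalSpace Λ]
  {D : Type u} [AddCommGroup D] [Module Λ D] [TopologicalSpace D] [DiscreteTopology D]
  [ContinuousSMul Λ D]
  (P : Type u) [CommRing P] [TopologicalSpace P] [Algebra P Λ] [Module P D]
  [IsScalarTower P Λ D] [ContinuousSMul P D]
  {ρ : ContinuousRep (GaloisGroupUnramifiedOutside K S) Λ D}

namespace Specification

/-- **`𝓛|_P`, the specification for `𝐃|_P` with "the same" local conditions**: `L|_P(K_v, 𝐃|_P)` is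
the preimage of `L(K_v, 𝐃)` under the comparison `H¹(K_v, 𝐃|_P) ≃+ H¹(K_v, 𝐃)`; it is a
`P`-submodule because the comparison is semilinear. (Print applies Prop. 2.6.3 to "`𝐃[Π]`
considered as a `Λ_Π`-module" with the specification `𝓛_Π` of §3.2 unchanged.)
[cite: Greenberg2016Selmer, §2.4 p. 8 L17–22; §4.1 p. 16 L1–8] -/
def restrictScalars (L : Specification S ρ) : Specification S (ρ.restrictScalars P) := fun v ↦
  { carrier := {c | localRestrictScalarsH S P ρ v 1 c ∈ L v}
    add_mem' := fun {a b} ha hb ↦ by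
      simp only [Set.mem_setOf_eq, map_add]
      exact (L v).add_mem ha hb
    zero_mem' := by
      simp only [Set.mem_setOf_eq, map_zero]
      exact (L v).zero_mem
    smul_mem' := fun a c hc ↦ by
      simp only [Set.mem_setOf_eq] at hc ⊢
      rw [localRestrictScalarsH_smul]
      exact (L v).smul_mem _ hc }

/-- Membership in `L|_P(K_v)`: the comparison lands in `L(K_v)`. [cite: Greenberg2016Selmer, §4.1 p. 16 L1–8] -/
theorem mem_restrictScalars_iff (L : Specification S ρ) (v : Place K)
    (c : (localRep S (ρ.restrictScalars P) v).H 1) :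
    c ∈ L.restrictScalars P v ↔ localRestrictScalarsH S P ρ v 1 c ∈ L v :=
  Iff.rfl

/-- The comparison maps `L|_P(K_v)` ONTO `L(K_v)`. [cite: Greenberg2016Selmer, §4.1 p. 16 L1–8] -/
theorem map_localRestrictScalarsH_restrictScalars (L : Specification S ρ) (v : Place K) :
    (L.restrictScalars P v).toAddSubgroup.map
        (localRestrictScalarsH S P ρ v 1 : _ →+ (localRep S ρ v).H 1) = (L v).toAddSubgroup := by
  ext x
  simp only [AddSubgroup.mem_map, Submodule.mem_toAddSubgroup, AddMonoidHom.coe_coe,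
    mem_restrictScalars_iff]
  constructor
  · rintro ⟨y, hy, rfl⟩
    exact hy
  · intro hx
    exact ⟨(localRestrictScalarsH S P ρ v 1).symm x, by simpa using hx, by simp⟩

/-- **`Q_{𝓛|_P}(K_v, 𝐃|_P) ≃+ Q_𝓛(K_v, 𝐃)`**, induced by the comparison of `H¹(K_v, ·)`.
[cite: Greenberg2016Selmer, §4.1 p. 16 L1–8; §1 p. 3 L24–25] -/
def QRestrictScalarsEquiv (L : Specification S ρ) (v : Place K) :
    (L.restrictScalars P).Q v ≃+ L.Q v :=
  QuotientAddGroup.congr (L.restrictScalars P v).toAddSubgroup (L v).toAddSubgroup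
    (localRestrictScalarsH S P ρ v 1) (map_localRestrictScalarsH_restrictScalars P L v)

/-- `QRestrictScalarsEquiv` on classes. [cite: Greenberg2016Selmer, §1 p. 3 L24–25] -/
@[simp] theorem QRestrictScalarsEquiv_mk (L : Specification S ρ) (v : Place K)
    (y : (localRep S (ρ.restrictScalars P) v).H 1) :
    QRestrictScalarsEquiv P L v (Submodule.Quotient.mk y) =
      Submodule.Quotient.mk (localRestrictScalarsH S P ρ v 1 y) :=
  rfl

/-- `QRestrictScalarsEquiv` is semilinear along `algebraMap P Λ`.
[cite: Brown1982CohomologyGroups, III.1 Example 3 (the standard complex does not involve the scalars)] -/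
theorem QRestrictScalarsEquiv_smul (L : Specification S ρ) (v : Place K) (a : P)
    (q : (L.restrictScalars P).Q v) :
    QRestrictScalarsEquiv P L v (a • q) = algebraMap P Λ a • QRestrictScalarsEquiv P L v q := by
  obtain ⟨y, rfl⟩ := Submodule.Quotient.mk_surjective _ q
  rw [← Submodule.Quotient.mk_smul, QRestrictScalarsEquiv_mk, QRestrictScalarsEquiv_mk,
    localRestrictScalarsH_smul, Submodule.Quotient.mk_smul]

/-- **`Q_{𝓛|_P}(K, 𝐃|_P) ≃+ Q_𝓛(K, 𝐃)`** (product over `v ∈ Σ` of the local comparisons).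
[cite: Greenberg2016Selmer, §1 p. 3 L23–25; §4.1 p. 16 L1–8] -/
def QGlobalRestrictScalarsEquiv (L : Specification S ρ) :
    (L.restrictScalars P).QGlobal ≃+ L.QGlobal :=
  AddEquiv.piCongrRight fun v : SigmaPlace S ↦ QRestrictScalarsEquiv P L v.1

/-- Components of `QGlobalRestrictScalarsEquiv`. [cite: Greenberg2016Selmer, §1 p. 3 L23–25] -/
@[simp] theorem QGlobalRestrictScalarsEquiv_apply (L : Specification S ρ)
    (q : (L.restrictScalars P).QGlobal) (v : SigmaPlace S) :
    QGlobalRestrictScalarsEquiv P L q v = QRestrictScalarsEquiv P L v.1 (q v) :=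
  rfl

/-- `QGlobalRestrictScalarsEquiv` is semilinear along `algebraMap P Λ`.
[cite: Brown1982CohomologyGroups, III.1 Example 3 (the standard complex does not involve the scalars)] -/
theorem QGlobalRestrictScalarsEquiv_smul (L : Specification S ρ) (a : P)
    (q : (L.restrictScalars P).QGlobal) :
    QGlobalRestrictScalarsEquiv P L (a • q) = algebraMap P Λ a • QGlobalRestrictScalarsEquiv P L q := by
  funext v
  simp only [QGlobalRestrictScalarsEquiv_apply, Pi.smul_apply, QRestrictScalarsEquiv_smul]

/-- **The square**: `Q_{𝓛|_P}(K) ≃+ Q_𝓛(K)` carries `φ_{𝓛|_P}` to `φ_𝓛 ∘ (H¹(K_Σ/K, 𝐃|_P) ≃+ H¹(K_Σ/K, 𝐃))`.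
[cite: Greenberg2016Selmer, §1 p. 3 (1); §4.1 p. 16 L1–8] -/
theorem QGlobalRestrictScalarsEquiv_phi (L : Specification S ρ) (c : (ρ.restrictScalars P).H 1) :
    QGlobalRestrictScalarsEquiv P L ((L.restrictScalars P).phi c) =
      L.phi (ContinuousRep.restrictScalarsH P ρ 1 c) := by
  funext v
  simp only [QGlobalRestrictScalarsEquiv_apply, phi, LinearMap.pi_apply, LinearMap.coe_comp,
    Function.comp_apply, Submodule.mkQ_apply, QRestrictScalarsEquiv_mk, loc_restrictScalarsH]

/-! ## §4. Consequences: SUR, `S_𝓛`, `Ш²`, LEO, LOC⁽¹⁾, divisibility of `Q_𝓛(K_v)` -/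

/-- **SUR does not see the scalars**: `SUR(𝐃|_P, 𝓛|_P) ↔ SUR(𝐃, 𝓛)`.
[cite: Greenberg2016Selmer, §2.3 p. 7 L6; §4.1 p. 16 L1–8] [cite: Greenberg2010, §3.1 p. 14 L33–35] -/
theorem sur_restrictScalars_iff (L : Specification S ρ) : (L.restrictScalars P).SUR ↔ L.SUR := by
  have hsq : (L.phi : ρ.H 1 → L.QGlobal) ∘ (ContinuousRep.restrictScalarsH P ρ 1) =
      (QGlobalRestrictScalarsEquiv P L) ∘ (L.restrictScalars P).phi :=
    funext fun c ↦ (QGlobalRestrictScalarsEquiv_phi P L c).symm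
  unfold SUR
  rw [← EquivLike.comp_surjective ((L.restrictScalars P).phi) (QGlobalRestrictScalarsEquiv P L),
    ← hsq, EquivLike.surjective_comp]

/-- **`S_{𝓛|_P}(K, 𝐃|_P)` is the preimage of `S_𝓛(K, 𝐃)`** under the global comparison.
[cite: Greenberg2016Selmer, §1 p. 3 L26–32; §4.1 p. 16 L1–8] -/
theorem mem_selmer_restrictScalars_iff (L : Specification S ρ) (c : (ρ.restrictScalars P).H 1) :
    c ∈ (L.restrictScalars P).selmer ↔ ContinuousRep.restrictScalarsH P ρ 1 c ∈ L.selmer := by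
  simp only [selmer, LinearMap.mem_ker, ← QGlobalRestrictScalarsEquiv_phi,
    map_eq_zero_iff _ (QGlobalRestrictScalarsEquiv P L).injective]

/-- **`S_{𝓛|_P}(K, 𝐃|_P) ≃+ S_𝓛(K, 𝐃)`** (restriction of the global comparison).
[cite: Greenberg2016Selmer, §1 p. 3 L26–32; §4.1 p. 16 L1–8] -/
def selmerRestrictScalarsEquiv (L : Specification S ρ) : (L.restrictScalars P).selmer ≃+ L.selmer where
  toFun c := ⟨ContinuousRep.restrictScalarsH P ρ 1 c, (mem_selmer_restrictScalars_iff P L c.1).1 c.2⟩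
  invFun c := ⟨(ContinuousRep.restrictScalarsH P ρ 1).symm c, by
    rw [mem_selmer_restrictScalars_iff, AddEquiv.apply_symm_apply]
    exact c.2⟩
  left_inv c := Subtype.ext ((ContinuousRep.restrictScalarsH P ρ 1).symm_apply_apply _)
  right_inv c := Subtype.ext ((ContinuousRep.restrictScalarsH P ρ 1).apply_symm_apply _)
  map_add' a b := Subtype.ext (map_add (ContinuousRep.restrictScalarsH P ρ 1) _ _)

/-- Underlying classes of `selmerRestrictScalarsEquiv`. [cite: Greenberg2016Selmer, §1 p. 3 L26–32] -/
@[simp] theorem coe_selmerRestrictScalarsEquiv (L : Specification S ρ) (c : (L.restrictScalars P).selmer) :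
    (selmerRestrictScalarsEquiv P L c : ρ.H 1) = ContinuousRep.restrictScalarsH P ρ 1 c :=
  rfl

/-- `selmerRestrictScalarsEquiv` is semilinear along `algebraMap P Λ`.
[cite: Brown1982CohomologyGroups, III.1 Example 3 (the standard complex does not involve the scalars)] -/
theorem selmerRestrictScalarsEquiv_smul (L : Specification S ρ) (a : P) (c : (L.restrictScalars P).selmer) :
    selmerRestrictScalarsEquiv P L (a • c) = algebraMap P Λ a • selmerRestrictScalarsEquiv P L c :=
  Subtype.ext (ContinuousRep.restrictScalarsH_smul P ρ 1 a c)

/-- **`Q_{𝓛|_P}(K_v, 𝐃|_P)` is `P`-divisible as soon as `Q_𝓛(K_v, 𝐃)` is divisible by the scalars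
`algebraMap P Λ a`, `a ≠ 0`** (the use of Prop. 2.6.3 (c) over `Λ_Π`: `Q_𝓛(K_η, 𝐃[π])` is divisible by
the elements of `Λ` prime to `π`, p. 16 L34–37, and `Λ_Π ∖ 0` maps into them).
[cite: Greenberg2016Selmer, §4.1 p. 16 L33–37] -/
theorem isDivisible_Q_restrictScalars (L : Specification S ρ) (v : Place K)
    (h : ∀ a : P, a ≠ 0 → ∀ q : L.Q v, ∃ t : L.Q v, algebraMap P Λ a • t = q) :
    IsDivisible P ((L.restrictScalars P).Q v) := by
  intro a ha q
  obtain ⟨t, ht⟩ := h a ha (QRestrictScalarsEquiv P L v q)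
  refine ⟨(QRestrictScalarsEquiv P L v).symm t, (QRestrictScalarsEquiv P L v).injective ?_⟩
  rw [QRestrictScalarsEquiv_smul, AddEquiv.apply_symm_apply, ht]

end Specification

/-- **`Ш²(K, Σ, 𝐃|_P)` is the preimage of `Ш²(K, Σ, 𝐃)`** under the comparison in degree `2`.
[cite: Greenberg2016Selmer, §2.2 p. 6 L22–28; §4.1 p. 16 L9–17] -/
theorem mem_sha2_restrictScalars_iff (c : (ρ.restrictScalars P).H 2) :
    c ∈ sha2 S (ρ.restrictScalars P) ↔ ContinuousRep.restrictScalarsH P ρ 2 c ∈ sha2 S ρ := by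
  simp only [mem_sha2_iff, loc_restrictScalarsH,
    map_eq_zero_iff _ (localRestrictScalarsH S P ρ _ 2).injective]

/-- **`Ш²(K, Σ, 𝐃|_P) = 0 ↔ Ш²(K, Σ, 𝐃) = 0`.** [cite: Greenberg2016Selmer, §2.2 p. 6 L22–28; §4.1 p. 16 L9–17] -/
theorem sha2_restrictScalars_eq_bot_iff : sha2 S (ρ.restrictScalars P) = ⊥ ↔ sha2 S ρ = ⊥ := by
  simp only [Submodule.eq_bot_iff]
  constructor
  · intro h x hx
    have hx' := h ((ContinuousRep.restrictScalarsH P ρ 2).symm x)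
      (by rw [mem_sha2_restrictScalars_iff, AddEquiv.apply_symm_apply]; exact hx)
    simpa using congrArg (ContinuousRep.restrictScalarsH P ρ 2) hx'
  · intro h x hx
    exact (map_eq_zero_iff _ (ContinuousRep.restrictScalarsH P ρ 2).injective).1
      (h _ ((mem_sha2_restrictScalars_iff P x).1 hx))

/-- **LEO(`𝐃|_P`) from `Ш²(K, Σ, 𝐃) = 0`** (the road taken by `SpecialisationTransfers.lean` for
`𝐃[π]`: `Ш²(K, Σ, 𝐃[π]) = 0` for almost all `π`). [cite: Greenberg2016Selmer, §2.2 p. 6 L22–35; §4.1 p. 16 L9–17] -/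
theorem leo_restrictScalars_of_sha2_eq_bot (h : sha2 S ρ = ⊥) : LEO S (ρ.restrictScalars P) := by
  have key : ∀ N : Submodule P ((ρ.restrictScalars P).H 2), N = ⊥ → IsCotorsion P N := by
    rintro N rfl
    exact isCotorsion_of_subsingleton
  exact key _ ((sha2_restrictScalars_eq_bot_iff P).2 h)

omit [DiscreteTopology D] [ContinuousSMul Λ D] [ContinuousSMul P D] in
/-- **LOC_v⁽¹⁾ does not see the scalars**: `LOC_v⁽¹⁾(𝐃|_P) ↔ LOC_v⁽¹⁾(𝐃)` — definitionally (the
condition only involves the `Γ_{K_v}`-module `𝐃`). [cite: Greenberg2016Selmer, §2 p. 5 L17, §2.1 p. 6 L5] -/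
theorem loc1_restrictScalars_iff (v : Place K) : LOC1 S (ρ.restrictScalars P) v ↔ LOC1 S ρ v :=
  Iff.rfl

omit [TopologicalSpace Λ] [TopologicalSpace D] [DiscreteTopology D] [ContinuousSMul Λ D]
  [TopologicalSpace P] [ContinuousSMul P D] in
/-- A `Λ`-module divisible by the scalars `algebraMap P Λ a`, `a ≠ 0`, is `P`-divisible (used for
`𝐃[π]` over `Λ_Π`: `𝐃[π]` is divisible by the elements of `Λ` prime to `π`, [Gr4] Cor. 2.6.1, p. 16 L8–9).
[cite: Greenberg2016Selmer, §4.1 p. 16 L8–9] -/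
theorem isDivisible_of_algebraMap_smul {M : Type u} [AddCommGroup M] [Module Λ M] [Module P M]
    [IsScalarTower P Λ M]
    (h : ∀ a : P, a ≠ 0 → ∀ x : M, ∃ t : M, algebraMap P Λ a • t = x) : IsDivisible P M := by
  intro a ha x
  obtain ⟨t, ht⟩ := h a ha x
  exact ⟨t, by rw [← algebraMap_smul Λ a t]; exact ht⟩

end Spec

/-! ## §5. Functoriality in the coefficients and `R`-stability under restriction of scalars -/

section Stable

variable {K : Type u} [Field K] [NumberField K] {S : Set (HeightOneSpectrum (𝓞 K))}
  {Λ : Type u} [CommRing Λ] [TopologicalSpace Λ]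
  {D : Type u} [AddCommGroup D] [Module Λ D] [TopologicalSpace D] [DiscreteTopology D]
  [ContinuousSMul Λ D]
  {D' : Type u} [AddCommGroup D'] [Module Λ D'] [TopologicalSpace D'] [DiscreteTopology D']
  [ContinuousSMul Λ D']
  (P : Type u) [CommRing P] [TopologicalSpace P] [Algebra P Λ] [Module P D]
  [IsScalarTower P Λ D] [ContinuousSMul P D] [Module P D'] [IsScalarTower P Λ D'] [ContinuousSMul P D']

/-- **The comparisons commute with the maps induced in the coefficients** (`Hmap`): for
`G`-equivariant continuous linear `f_P : 𝐃|_P → 𝐃'|_P` over `P` and `f : 𝐃 → 𝐃'` over `Λ` with the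
same underlying function, `e' ∘ H(f_P) = H(f) ∘ e`.
[cite: Brown1982CohomologyGroups, III.1 Example 3 (the standard complex does not involve the scalars)] -/
theorem restrictScalarsH_Hmap {G : Type u} [Group G] [TopologicalSpace G] [IsTopologicalGroup G]
    (τ : ContinuousRep G Λ D) (τ' : ContinuousRep G Λ D') (fP : D →L[P] D')
    (hfP : ∀ (g : G) (m : D), fP (τ.restrictScalars P g m) = τ'.restrictScalars P g (fP m))
    (f : D →L[Λ] D') (hf : ∀ (g : G) (m : D), f (τ g m) = τ' g (f m))
    (hff : ∀ m : D, fP m = f m) (n : ℕ) (x : (τ.restrictScalars P).H n) :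
    ContinuousRep.restrictScalarsH P τ' n (Hmap (τ.restrictScalars P) (τ'.restrictScalars P) fP hfP n x) =
      Hmap τ τ' f hf n (ContinuousRep.restrictScalarsH P τ n x) :=
  continuousCohomologyAddEquiv_map (X := (τ.restrictScalars P).toTopRep) (X' := τ.toTopRep)
    (Y := (τ'.restrictScalars P).toTopRep) (Y' := τ'.toTopRep)
    (ContinuousAddEquiv.refl D) (fun _ _ ↦ rfl) (ContinuousAddEquiv.refl D') (fun _ _ ↦ rfl)
    (ContinuousMonoidHom.id G)
    (TopRep.ofHom ⟨fP, fun g ↦ by ext m; exact hfP g m⟩)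
    (TopRep.ofHom ⟨f, fun g ↦ by ext m; exact hf g m⟩) (fun m ↦ hff m) n x

variable {ρ : ContinuousRep (GaloisGroupUnramifiedOutside K S) Λ D}

/-- The comparison at a place commutes with the scalars of an auxiliary ring `R` acting on `𝐃`
(`localScalar`, read over `P` and over `Λ`). [cite: Greenberg2016Selmer, §1 p. 3 L15–21] -/
theorem localRestrictScalarsH_localScalar {R : Type u} [CommRing R] [Module R D]
    [SMulCommClass R Λ D] [SMulCommClass R P D]
    (hR : ∀ (g : GaloisGroupUnramifiedOutside K S) (r : R) (d : D), ρ g (r • d) = r • ρ g d)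
    (v : Place K) (r : R) (n : ℕ) (x : (localRep S (ρ.restrictScalars P) v).H n) :
    localRestrictScalarsH S P ρ v n
        (localScalar S (ρ.restrictScalars P) v r (fun g d ↦ hR g r d) n x) =
      localScalar S ρ v r (fun g d ↦ hR g r d) n (localRestrictScalarsH S P ρ v n x) :=
  restrictScalarsH_Hmap P (localRep S ρ v) (localRep S ρ v) _ _ _ _ (fun _ ↦ rfl) n x

/-- **`R`-stability does not see the scalars**: if `𝓛` is a specification by `R`-submodules
(`IsStable`), so is `𝓛|_P`. [cite: Greenberg2016Selmer, §1 p. 3 L19–21; §4.1 p. 16 L1–8] -/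
theorem Specification.isStable_restrictScalars (L : Specification S ρ) {R : Type u} [CommRing R]
    [Module R D] [SMulCommClass R Λ D] [SMulCommClass R P D]
    (hR : ∀ (g : GaloisGroupUnramifiedOutside K S) (r : R) (d : D), ρ g (r • d) = r • ρ g d)
    (hL : L.IsStable hR) :
    (L.restrictScalars P).IsStable (R := R) (fun g r d ↦ hR g r d) := by
  intro v hv r c hc
  rw [Specification.mem_restrictScalars_iff] at hc ⊢
  rw [localRestrictScalarsH_localScalar P hR v r 1 c]
  exact hL v hv r _ hc

end Stable

end Literature.NumberTheory.IwasawaTheory.Greenberg2016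

end
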